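import Literature.Analysis.FluidPDE.VectorCalculus
import Literature.Analysis.FluidPDE.WeakSolution
import Literature.Analysis.FluidPDE.LerayHopf
import Literature.Analysis.FluidPDE.LerayProjector
import Literature.Analysis.UnboundedOperators.HeatKernel
import Literature.Analysis.FunctionSpaces.Complexify
import Literature.Analysis.FunctionSpaces.FourierSobolevNorm
import HarnessLib

-- provenance: harness21/H21/H21/Prelude/FluidKinetic/MildSolution.lean @ 7bf07d3 (interim HEAD d8f2665); M5 mechanical rewrite
/-!
# Mild (very weak, duality-form) solutions of the Navier–Stokes equations

Trunk: FluidKinetic (outline `H21/Outlines/FluidKinetic.md`, item F8 `MildSolution`; notion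
`mild_solution`).

Let `E` be a finite-dimensional real inner product space with Lebesgue measure. A *mild solution*
of the forced incompressible Navier–Stokes system `∂ₜu + (u·∇)u + ∇p = νΔu + f`, `div u = 0`,
`u(0) = u₀` is a solution of the Duhamel integral equation
`u(t) = e^{νtΔ} u₀ - ∫₀ᵗ e^{ν(t-τ)Δ} P div (u ⊗ u)(τ) dτ + ∫₀ᵗ e^{ν(t-τ)Δ} P f(τ) dτ`
(Kato 1984, (1.7); `P` the Leray projector). Following Fabes–Jones–Rivière (1972, Thm. 2.1) and
Lemarié-Rieusset (2002, Thm. 11.2) we take as *definition* the equivalent **duality ("very weak")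
form**: for every smooth compactly supported divergence-free test field `φ` and `0 ≤ s ≤ t`,
`∫ ⟪u(t), φ⟫ = ∫ ⟪u(s), e^{ν(t-s)Δ}φ⟫ + ∫ₛᵗ ∫ ⟪u, (u·∇) e^{ν(t-τ)Δ}φ⟫ + ∫ₛᵗ ∫ ⟪f, e^{ν(t-τ)Δ}φ⟫`,
obtained by testing the equation with `ψ(τ) = e^{ν(t-τ)Δ}φ` (which solves the backward heat
equation, so that the `∂ₜ` and `νΔ` terms cancel; the pressure drops out since `e^{τΔ}φ` is
divergence free). No Leray projector on `L^p` is needed for the definition; the link with the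
semigroup Duhamel formula in `L²` is `isMildNSSolutionOn_iff_duhamel_two`.

## Main definitions

* `Literature.Fluid.heatFlow φ τ`: the heat semigroup `e^{τΔ}φ` for **all** `τ ≥ 0`, i.e. the accepted
  caloric extension `Literature.heatExtension φ τ` for `0 < τ` and `φ` itself for `τ = 0`.
* `Literature.Fluid.heatTest ν φ τ = e^{ντΔ}φ`, the caloric test field.
* `Literature.Fluid.heatDivTensor τ v w = e^{τΔ} div (v ⊗ w)`, the heat-smoothed nonlinearity (as an
  explicit convolution with `∇ heatKernel τ`), used to state the `L²` Duhamel formula.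
* `Literature.Fluid.IsMildNSSolutionBetween ν f u s t`, `Literature.Fluid.IsMildNSSolutionFrom ν f u₀ u t`,
  `Literature.Fluid.IsMildNSSolutionOn S ν f u₀ u`, `Literature.Fluid.IsGlobalMildSolution ν f u₀ u`.
* `Literature.Fluid.ContinuousInHomSobolevOn S s u` (`u ∈ C(S; Ḣ^s ∩ L²)`, `EuclideanSpace` only),
  `Literature.Fluid.IsBoundedOn S u` (`u ∈ L^∞(S × X)` pointwise).

## Mathlib search

Mathlib (this pin) has no heat semigroup on functions, no mild/very weak Navier–Stokes notion
(searched `mild`, `Duhamel`, `NavierStokes`, `heat` in `Analysis/`: nothing relevant), and no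
`IsBoundedOn` predicate for two-parameter families (it could be spelled
`Bornology.IsBounded (range fun q : S × X => u q.1 q.2)` or with `BddAbove`; the explicit
`∃ C` form prescribed by the outline is kept as it is what statements consume). Used from
Mathlib: `intervalIntegral` (`∫ τ in s..t`), Bochner `integral`, `MemLp`, `MemLp.toLp`,
`eLpNorm`, `Lp`, `fderiv`, `nhdsWithin` (the Mathlib files
`MeasureTheory.Integral.IntervalIntegral.Basic` and `Analysis.Convolution` listed in the outline
are imported transitively through the H21 modules below, so they are not re-imported). From H21: `heatExtension`, `heatKernel` (G07), `IsTestFunctionOn` (G03),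
`IsDivFree`, `convect`, `IsWeaklyDivFree` (F1), `IsWeakNSSolutionOn` (F4), `ContinuousInLpOn`,
`MemLqLp` (F5), `lerayProjector` (F6), `MemHomSobolev`, `Function.eHomSobolevSeminorm`,
`EuclideanSpace.complexify` (G03).

**Internal near-duplicate, deliberately not used.** H21 also has the accepted
`Literature.SchwartzMap.heatSemigroup t : 𝓢(E, F) →L[ℂ] 𝓢(E, F)` and
`Literature.TemperedDistribution.heatSemigroup` (`H21/Prelude/UnbddOp/HeatSemigroup.lean`), the Fourier
multiplier `e^{-t|ξ|²}` on complex Schwartz functions / tempered distributions. Mild solutions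
here are raw real-valued fields `u : ℝ → E → E` paired pointwise with real test fields, so the
semigroup must act on plain functions `E → F` over `ℝ`; this is what the accepted convolution
`Literature.Analysis.UnboundedOperators.heatExtension` (`HeatKernel.lean`) provides, and `heatFlow` below is a thin `τ = 0` wrapper
around it, not a third heat semigroup.

## Design notes

* **`t = 0` (review finding 1).** The accepted `heatExtension f 0` is *not* `f`: `heatKernel 0 = 0`
  (`Real.rpow 0 (-n/2) = 0`), so `heatExtension f 0 = 0`, and `heatExtension f t` is junk for
  `t ≤ 0`. Hence `heatFlow φ τ := if 0 < τ then heatExtension φ τ else φ`, which is `e^{τΔ}φ` for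
  every `τ ≥ 0` with `e^{0Δ} = id` (`heatFlow_zero`, `heatFlow_of_pos`); for `τ < 0` the value `φ`
  is a documented junk value. With this device the duality identity at `s = t` is the tautology
  `∫⟪u t, φ⟫ = ∫⟪u t, φ⟫` (`IsMildNSSolutionBetween.refl`) and at `t = 0` it is the weak initial
  condition `∫⟪u 0 - u₀, φ⟫ = 0` for div-free tests (`isMildNSSolutionFrom_zero_iff`).
* `heatTest ν φ τ := heatFlow φ (ν * τ)`; for `ν = 0` this is the identity semigroup and the
  "mild" identity degenerates. **Every statement about mild solutions takes `0 < ν` as an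
  explicit hypothesis.**
* The test fields `φ` are `C_c^∞` and divergence free; `e^{ντΔ}φ` is then Schwartz and divergence
  free but not compactly supported, so transitivity of the two-time identity
  (`IsMildNSSolutionBetween.trans`) needs an integrability class for `u` (here `L^∞_t L^q_x`,
  `q ≥ 2`) to extend the identity to such tests by density; this is Lemarié-Rieusset's remark that
  "mild ⇔ very weak" holds *in the classes used* (2002, Thm. 11.2).
* **Junk integrals.** As in the accepted `IsWeakNSSolutionOn`, the Bochner integrals `∫ x, …`
  and `∫ τ in s..t, …` in the duality identities are Mathlib's, hence `0` when the integrand is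
  not integrable. The bare predicates are therefore only meaningful inside an integrability
  class, and every theorem below carries such a class hypothesis explicitly. This applies in
  particular to the **datum** `u₀`, which enters `IsMildNSSolutionFrom` only through
  `∫ ⟪u₀, e^{νtΔ}φ⟫` (junk `0` if `u₀` grows faster than every Gaussian), whereas the accepted
  weak formulation pairs `u₀` with a compactly supported `ψ 0`; hence every theorem relating the
  two carries `u₀ ∈ L^p` (`MemLp u₀ p`), the class of Fabes–Jones–Rivière / Kato.
* `ContinuousInHomSobolevOn` is `EuclideanSpace`-only because the accepted complexification
  `EuclideanSpace.complexify` (needed to feed real fields into the complex Fourier-side Sobolev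
  norms) lives there. The accepted `MemHomSobolev s` / `Function.eHomSobolevSeminorm s`
  (`FourierSobolevNorm.lean`) are the `Ḣ^s ∩ L²` versions with junk value `∞` off `L²` (review
  finding 7b); for the Fujita–Kato data `s = 1/2` of finite energy this is harmless, but it is
  *not* the full homogeneous space `Ḣ^s`.

## References

* E. B. Fabes, B. F. Jones, N. M. Rivière, *The initial value problem for the Navier–Stokes
  equations with data in `L^p`*, Arch. Rational Mech. Anal. 45 (1972), 222–240, Thm. 2.1.
* T. Kato, *Strong `L^p`-solutions of the Navier–Stokes equation in `ℝ^m`, with applications to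
  weak solutions*, Math. Z. 187 (1984), 471–480, (1.7) and Thm. 1–4.
* P. G. Lemarié-Rieusset, *Recent developments in the Navier–Stokes problem* (2002), Ch. 11,
  Thm. 11.2; Ch. 27 (uniqueness in `C([0,T); L³)`).
* G. Furioli, P. G. Lemarié-Rieusset, E. Terraneo, *Unicité dans `L³(ℝ³)` et d'autres espaces
  fonctionnels limites pour Navier–Stokes*, Rev. Mat. Iberoam. 16 (2000), Thm. 1.
* H. Fujita, T. Kato, *On the Navier–Stokes initial value problem. I*, ARMA 16 (1964), §1.
-/

noncomputable section

open MeasureTheory TopologicalSpace Set Function Filter Topology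
open scoped InnerProductSpace RealInnerProductSpace ENNReal NNReal

namespace Literature.Analysis.FluidPDE

/-! ### The heat semigroup for all `τ ≥ 0` -/

section HeatFlow

variable {E : Type*} [NormedAddCommGroup E] [InnerProductSpace ℝ E] [FiniteDimensional ℝ E]
  [MeasurableSpace E] [BorelSpace E]
variable {F : Type*} [NormedAddCommGroup F] [NormedSpace ℝ F]

/-- The **heat semigroup** `heatFlow φ τ = e^{τΔ} φ` for all `τ ≥ 0`: the accepted caloric
extension `heatExtension φ τ = heatKernel τ ⋆ φ` for `0 < τ` and `φ` itself at `τ = 0`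
(`e^{0Δ} = id`; the accepted `heatExtension φ 0` is the junk value `0` since `heatKernel 0 = 0`).
**Junk value** `φ` for `τ < 0`. Evans, *PDE*, §2.3.1; Kato 1984, §1 (`U(t) = e^{tΔ}`). [cite: Kato1984, §1 ( U(t] -/
def heatFlow (φ : E → F) (τ : ℝ) : E → F :=
  if 0 < τ then UnboundedOperators.heatExtension φ τ else φ

/-- `e^{0Δ} = id`: `heatFlow φ 0 = φ` (Evans, *PDE*, §2.3.1, Thm. 1 (iii)). [folklore] -/
@[simp]
theorem heatFlow_zero (φ : E → F) : heatFlow φ 0 = φ := by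
  simp [heatFlow]

/-- For `0 < τ` the heat flow is the caloric extension `heatKernel τ ⋆ φ`
(Evans, *PDE*, §2.3.1, (12)). [folklore] -/
theorem heatFlow_of_pos (φ : E → F) {τ : ℝ} (hτ : 0 < τ) : heatFlow φ τ = UnboundedOperators.heatExtension φ τ :=
  if_pos hτ

/-- For `τ ≤ 0` the heat flow is (by definition, junk for `τ < 0`) the identity
(definitional; see `heatFlow`). [folklore] -/
theorem heatFlow_of_nonpos (φ : E → F) {τ : ℝ} (hτ : τ ≤ 0) : heatFlow φ τ = φ :=
  if_neg (not_lt.2 hτ)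

/-- Semigroup law `e^{tΔ} e^{sΔ} f = e^{(s+t)Δ} f` for `f ∈ L^p`, `1 ≤ p`, and all `0 ≤ s, t`
(from the accepted `heatExtension_add` for `0 < s, t`; the cases `s = 0` or `t = 0` are
definitional). Evans, *PDE*, §2.3.1. [folklore] -/
def heatFlow_heatFlow : Prop :=
  ∀ [CompleteSpace F] {f : E → F} {p : ℝ≥0∞} (hf : MemLp f p) (hp : 1 ≤ p) {s t : ℝ} (hs : 0 ≤ s) (ht : 0 ≤ t),
    heatFlow (heatFlow f s) t = heatFlow f (s + t)

/- interim proof relied on results that are now named facts (D-0014); demoted to a fact by the M5 import, proof preserved: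
:= by
  rcases hs.eq_or_lt with rfl | hs
  · simp
  rcases ht.eq_or_lt with rfl | ht
  · simp
  rw [heatFlow_of_pos _ hs, heatFlow_of_pos _ ht, heatFlow_of_pos _ (add_pos hs ht),
    heatExtension_add hf hp hs ht]
-/

/-- The heat flow of an `L^p` function is in `L^p` for all `0 ≤ t` (`1 ≤ p ≤ ∞`).
Giga–Giga–Saal, *Nonlinear PDEs*, §1.1.2. [folklore] -/
def memLp_heatFlow : Prop :=
  ∀ [CompleteSpace F] {f : E → F} {p : ℝ≥0∞} (hf : MemLp f p) (hp : 1 ≤ p) {t : ℝ} (ht : 0 ≤ t),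
    MemLp (heatFlow f t) p

/- interim proof relied on results that are now named facts (D-0014); demoted to a fact by the M5 import, proof preserved:
:= by
  rcases ht.eq_or_lt with rfl | ht
  · simpa using hf
  rw [heatFlow_of_pos _ ht]
  exact memLp_heatExtension hf hp ht
-/

/-- `L^p` contraction `‖e^{tΔ} f‖_p ≤ ‖f‖_p` for all `0 ≤ t` (`1 ≤ p ≤ ∞`).
Giga–Giga–Saal, *Nonlinear PDEs*, §1.1.2. [folklore] -/
def eLpNorm_heatFlow_le : Prop :=
  ∀ [CompleteSpace F] {f : E → F} {p : ℝ≥0∞} (hf : MemLp f p) (hp : 1 ≤ p) {t : ℝ} (ht : 0 ≤ t),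
    eLpNorm (heatFlow f t) p volume ≤ eLpNorm f p volume

/- interim proof relied on results that are now named facts (D-0014); demoted to a fact by the M5 import, proof preserved:
:= by
  rcases ht.eq_or_lt with rfl | ht
  · simp
  rw [heatFlow_of_pos _ ht]
  exact eLpNorm_heatExtension_le hf hp ht
-/

/-- Strong continuity at `t = 0` from the right, *including* `t = 0`: for `f ∈ L^p`,
`1 ≤ p < ∞`, `‖e^{tΔ} f - f‖_p → 0` as `t → 0`, `t ≥ 0` (from the accepted
`tendsto_heatExtension_nhdsWithin_zero` on `t > 0` and `heatFlow_zero` at `t = 0`).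
Stein, *Singular Integrals*, Ch. III §2, Thm. 2; Evans, *PDE*, §2.3.1, Thm. 1 (iii). [folklore] -/
def tendsto_heatFlow_nhdsWithin_zero : Prop :=
  ∀ [CompleteSpace F] {f : E → F} {p : ℝ≥0∞} (hf : MemLp f p) (hp : 1 ≤ p) (hp' : p ≠ ∞),
    Tendsto (fun t : ℝ => eLpNorm (heatFlow f t - f) p volume) (𝓝[≥] 0) (𝓝 0)

/- interim proof relied on results that are now named facts (D-0014); demoted to a fact by the M5 import, proof preserved:
:= by
  have h : Tendsto (fun t : ℝ => eLpNorm (heatFlow f t - f) p volume) (𝓝[>] 0) (𝓝 0) :=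
    (tendsto_heatExtension_nhdsWithin_zero hf hp hp').congr'
      (eventually_nhdsWithin_of_forall fun t ht => by
        simp only [heatFlow_of_pos f (mem_Ioi.1 ht)])
  rw [← Ioi_insert, nhdsWithin_insert, tendsto_sup]
  exact ⟨by simpa using tendsto_pure_nhds (fun t : ℝ => eLpNorm (heatFlow f t - f) p volume) 0, h⟩
-/

/-- The **caloric test field** `heatTest ν φ τ = e^{ντΔ} φ` (viscosity `ν`, elapsed time `τ ≥ 0`),
the solution at time `τ` of the backward-in-time Stokes-heat equation with final datum `φ`
used to test the Navier–Stokes system in duality form (Fabes–Jones–Rivière 1972, §2, Thm. 2.1;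
Lemarié-Rieusset 2002, Ch. 11). For `ν = 0` this is the identity semigroup: statements about
mild solutions always assume `0 < ν`. [cite: FabesJonesRiviere1972, §2  Thm. 2.1] -/
def heatTest (ν : ℝ) (φ : E → F) (τ : ℝ) : E → F :=
  heatFlow φ (ν * τ)

/-- At elapsed time `0` the caloric test field is the test field itself (definitional;
`e^{0Δ} = id`, Fabes–Jones–Rivière 1972, §2). [cite: FabesJonesRiviere1972, §2] -/
@[simp]
theorem heatTest_zero_right (ν : ℝ) (φ : E → F) : heatTest ν φ 0 = φ := by
  simp [heatTest]

/-- Degenerate case `ν = 0` (documented junk: the identity semigroup; definitional, see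
`heatTest`). [folklore] -/
@[simp]
theorem heatTest_zero_left (φ : E → F) (τ : ℝ) : heatTest 0 φ τ = φ := by
  simp [heatTest]

/-- For `0 < ν` and `0 < τ` the caloric test field is the caloric extension at time `ντ`
(Fabes–Jones–Rivière 1972, §2). [cite: FabesJonesRiviere1972, §2] -/
theorem heatTest_of_pos {ν τ : ℝ} (hν : 0 < ν) (hτ : 0 < τ) (φ : E → F) :
    heatTest ν φ τ = UnboundedOperators.heatExtension φ (ν * τ) :=
  heatFlow_of_pos φ (mul_pos hν hτ)

/-- The **heat-smoothed divergence of a tensor product**,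
`heatDivTensor τ v w = e^{τΔ} div (v ⊗ w)`, componentwise
`(e^{τΔ} ∑ⱼ ∂ⱼ (vⱼ wᵢ))(x) = ∫ ⟪∇K_τ(x - y), v(y)⟫ wᵢ(y) dy` with `K_τ = heatKernel τ`
(integration by parts inside the convolution), written directly as the absolutely convergent
integral `∫ (D K_τ)(x - y)[v y] • w y dy` so that it makes sense for `v, w ∈ L²` (then
`v ⊗ w ∈ L¹` and `∇K_τ ∈ L^∞`). For `v = w = u(τ)` divergence free this is
`e^{τΔ} (u·∇)u = e^{τΔ} div (u ⊗ u)`, the Duhamel integrand of Kato 1984, (1.7), (2.3').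
**Junk values:** junk for `τ ≤ 0` (`heatKernel τ` is junk there), and, as a Bochner integral,
`0` when the integrand is not integrable (and `0` if `F` is not complete; it is only used with
the finite-dimensional `F = E`). [cite: Kato1984, (1.7] -/
def heatDivTensor (τ : ℝ) (v : E → E) (w : E → F) (x : E) : F :=
  ∫ y, (fderiv ℝ (UnboundedOperators.heatKernel (E := E) τ) (x - y) (v y)) • w y

end HeatFlow

/-! ### Function classes -/

section Classes

/-- `u` is (pointwise, uniformly) bounded on the time set `S`: `∃ C, ∀ t ∈ S, ∀ x, ‖u t x‖ ≤ C`,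
i.e. `u ∈ L^∞(S × X)` for everywhere-defined fields (Kato 1984, Thm. 4 (regular class);
Koch–Nadirashvili–Seregin–Šverák 2009, §1, bounded ancient solutions). [cite: Kato1984, Thm. 4 (regular class] -/
def IsBoundedOn {X F : Type*} [Norm F] (S : Set ℝ) (u : ℝ → X → F) : Prop :=
  ∃ C : ℝ, ∀ t ∈ S, ∀ x, ‖u t x‖ ≤ C

/-- Boundedness is monotone in the time set (definitional; see `IsBoundedOn`). [folklore] -/
theorem IsBoundedOn.mono {X F : Type*} [Norm F] {S S' : Set ℝ} {u : ℝ → X → F}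
    (h : IsBoundedOn S u) (hS : S' ⊆ S) : IsBoundedOn S' u :=
  h.imp fun _ hC t ht x => hC t (hS ht) x

/-- `u ∈ C(S; Ḣ^s ∩ L²)` for real vector fields on `ℝ^ι` (**`EuclideanSpace` only**, since the
accepted complexification `EuclideanSpace.complexify`, needed to feed real fields into the complex
Fourier-side Sobolev norms, lives there): every slice `u t`, `t ∈ S`, lies in `Ḣ^s ∩ L²`
(`MemHomSobolev s`), and `‖u t - u t₀‖_{Ḣ^s} → 0` as `t → t₀` within `S`
(`Function.eHomSobolevSeminorm s`). **Caveat (review finding 7b):** the accepted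
`MemHomSobolev`/`Function.eHomSobolevSeminorm` (`FourierSobolevNorm.lean`) are the `Ḣ^s ∩ L²`
versions with junk value `∞` off `L²`; for the Fujita–Kato class `s = 1/2` with finite-energy
data this is the classical space (Fujita–Kato 1964, §1; Lemarié-Rieusset 2002, Ch. 15), but it is
not the full homogeneous space `Ḣ^s`. Twin of `Fluid.ContinuousInLpOn`. [cite: FujitaKato1964, §1] -/
def ContinuousInHomSobolevOn {ι : Type*} [Fintype ι] (S : Set ℝ) (s : ℝ)
    (u : ℝ → EuclideanSpace ℝ ι → EuclideanSpace ℝ ι) : Prop :=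
  (∀ t ∈ S, FunctionSpaces.MemHomSobolev s (FunctionSpaces.EuclideanSpace.complexify ∘ u t)) ∧
    ∀ t₀ ∈ S, Tendsto (fun t => Function.eHomSobolevSeminorm s
      (FunctionSpaces.EuclideanSpace.complexify ∘ (u t - u t₀))) (𝓝[S] t₀) (𝓝 0)

/-- `ContinuousInHomSobolevOn` is monotone in the time set (definitional; see
`ContinuousInHomSobolevOn`, Fujita–Kato 1964, §1). [cite: FujitaKato1964, §1] -/
theorem ContinuousInHomSobolevOn.mono {ι : Type*} [Fintype ι] {S S' : Set ℝ} {s : ℝ}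
    {u : ℝ → EuclideanSpace ℝ ι → EuclideanSpace ℝ ι} (h : ContinuousInHomSobolevOn S s u)
    (hS : S' ⊆ S) : ContinuousInHomSobolevOn S' s u :=
  ⟨fun t ht => h.1 t (hS ht), fun t₀ ht₀ => (h.2 t₀ (hS ht₀)).mono_left (nhdsWithin_mono _ hS)⟩

end Classes

/-! ### Mild solutions in duality form -/

section Mild

variable {E : Type*} [NormedAddCommGroup E] [InnerProductSpace ℝ E] [FiniteDimensional ℝ E]
  [MeasurableSpace E] [BorelSpace E]

/-- **Two-time duality identity** (Fabes–Jones–Rivière 1972, Thm. 2.1; Lemarié-Rieusset 2002,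
Thm. 11.2): `u` is a *mild (very weak) solution between times `s` and `t`* of Navier–Stokes with
viscosity `ν` and force `f` if for every smooth compactly supported divergence-free test field
`φ` on `E`
`∫ ⟪u t, φ⟫ = ∫ ⟪u s, e^{ν(t-s)Δ}φ⟫ + ∫ₛᵗ ∫ ⟪u τ, (u τ·∇) e^{ν(t-τ)Δ}φ⟫ dτ
  + ∫ₛᵗ ∫ ⟪f τ, e^{ν(t-τ)Δ}φ⟫ dτ`,
the identity obtained by testing the equation against `ψ(τ) = e^{ν(t-τ)Δ}φ` on `[s, t] × E`.
Intended for `s ≤ t` and `0 < ν`; at `s = t` it is a tautology (`IsMildNSSolutionBetween.refl`).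
Divergence-freeness of `u` is *not* part of this predicate (see `IsMildNSSolutionOn`).
**Junk values:** all integrals are Bochner integrals, hence `0` for non-integrable integrands
(same convention as `Fluid.IsWeakNSSolutionOn`); the predicate is meaningful only together with
an integrability class on `u`, `f`, which every theorem below assumes explicitly. [cite: FabesJonesRiviere1972, Thm. 2.1] -/
def IsMildNSSolutionBetween (ν : ℝ) (f u : ℝ → E → E) (s t : ℝ) : Prop :=
  ∀ φ : E → E, FunctionSpaces.IsTestFunctionOn (⊤ : Opens E) φ → VectorCalculus.IsDivFree φ →
    ∫ x, ⟪u t x, φ x⟫ = (∫ x, ⟪u s x, heatTest ν φ (t - s) x⟫) +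
      (∫ τ in s..t, ∫ x, ⟪u τ x, convect (u τ) (heatTest ν φ (t - τ)) x⟫) +
      ∫ τ in s..t, ∫ x, ⟪f τ x, heatTest ν φ (t - τ) x⟫

/-- **Duality identity from the initial datum** (Fabes–Jones–Rivière 1972, Thm. 2.1; Kato 1984,
(1.7) in tested form): for every smooth compactly supported divergence-free `φ`,
`∫ ⟪u t, φ⟫ = ∫ ⟪u₀, e^{νtΔ}φ⟫ + ∫₀ᵗ ∫ ⟪u τ, (u τ·∇) e^{ν(t-τ)Δ}φ⟫ dτ + ∫₀ᵗ ∫ ⟪f τ, e^{ν(t-τ)Δ}φ⟫ dτ`.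
At `t = 0` this is exactly the weak initial condition `∫ ⟪u 0 - u₀, φ⟫ = 0` for all div-free
tests (`isMildNSSolutionFrom_zero_iff`). Intended for `0 ≤ t` and `0 < ν`. **Junk values:**
the Bochner integrals are `0` for non-integrable integrands (as in `Fluid.IsWeakNSSolutionOn`);
use only together with an integrability class on `u`, `f`. [cite: FabesJonesRiviere1972, Thm. 2.1] -/
def IsMildNSSolutionFrom (ν : ℝ) (f : ℝ → E → E) (u₀ : E → E) (u : ℝ → E → E) (t : ℝ) : Prop :=
  ∀ φ : E → E, FunctionSpaces.IsTestFunctionOn (⊤ : Opens E) φ → VectorCalculus.IsDivFree φ →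
    ∫ x, ⟪u t x, φ x⟫ = (∫ x, ⟪u₀ x, heatTest ν φ t x⟫) +
      (∫ τ in 0..t, ∫ x, ⟪u τ x, convect (u τ) (heatTest ν φ (t - τ)) x⟫) +
      ∫ τ in 0..t, ∫ x, ⟪f τ x, heatTest ν φ (t - τ) x⟫

/-- **Mild solutions on a time set** `S ⊆ [0, ∞)` (Kato 1984, (1.7); Fabes–Jones–Rivière 1972,
Thm. 2.1): every slice `u t`, `t ∈ S`, is weakly divergence free and satisfies the duality
identity from the datum `u₀`. [cite: Kato1984, (1.7] -/
def IsMildNSSolutionOn (S : Set ℝ) (ν : ℝ) (f : ℝ → E → E) (u₀ : E → E) (u : ℝ → E → E) :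
    Prop :=
  (∀ t ∈ S, IsWeaklyDivFree (u t)) ∧ ∀ t ∈ S, IsMildNSSolutionFrom ν f u₀ u t

/-- **Global mild solutions**: mild solutions on `[0, ∞)` (Kato 1984, Thm. 3–4). [cite: Kato1984, Thm. 3–4] -/
def IsGlobalMildSolution (ν : ℝ) (f : ℝ → E → E) (u₀ : E → E) (u : ℝ → E → E) : Prop :=
  IsMildNSSolutionOn (Ici 0) ν f u₀ u

variable {ν T : ℝ} {f u v : ℝ → E → E} {u₀ : E → E} {p : ℝ → E → ℝ}

/-- At `s = t` the two-time duality identity is the tautology `∫⟪u t, φ⟫ = ∫⟪u t, φ⟫`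
(`e^{0Δ} = id`, empty time integrals; Fabes–Jones–Rivière 1972, Thm. 2.1). [cite: FabesJonesRiviere1972, Thm. 2.1] -/
theorem IsMildNSSolutionBetween.refl (ν : ℝ) (f u : ℝ → E → E) (t : ℝ) :
    IsMildNSSolutionBetween ν f u t t := by
  intro φ _ _
  simp

/-- **Sanity check at `t = 0`.** The duality identity from the datum at time `0` says exactly
that `u 0` and `u₀` have the same pairing with every smooth compactly supported divergence-free
field, i.e. the weak (Leray-projected) initial condition `P (u 0) = P u₀`
(Kato 1984, (1.7) at `t = 0`; Lemarié-Rieusset 2002, Thm. 11.2). [cite: Kato1984, (1.7] -/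
theorem isMildNSSolutionFrom_zero_iff :
    IsMildNSSolutionFrom ν f u₀ u 0 ↔ ∀ φ : E → E, FunctionSpaces.IsTestFunctionOn (⊤ : Opens E) φ →
      VectorCalculus.IsDivFree φ → ∫ x, ⟪u 0 x, φ x⟫ = ∫ x, ⟪u₀ x, φ x⟫ := by
  simp [IsMildNSSolutionFrom]

/-- The identity from the datum `u 0` is the two-time identity between `0` and `t`
(definitional; Fabes–Jones–Rivière 1972, Thm. 2.1 with `s = 0`). [cite: FabesJonesRiviere1972, Thm. 2.1 with  s = 0] -/
theorem isMildNSSolutionFrom_self_iff {t : ℝ} :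
    IsMildNSSolutionFrom ν f (u 0) u t ↔ IsMildNSSolutionBetween ν f u 0 t := by
  simp only [IsMildNSSolutionFrom, IsMildNSSolutionBetween, sub_zero]

/-- A global mild solution is a mild solution on every `[0, T)` (definitional; Kato 1984,
Thm. 3–4). [cite: Kato1984, Thm. 3–4] -/
theorem IsGlobalMildSolution.isMildNSSolutionOn (h : IsGlobalMildSolution ν f u₀ u) (T : ℝ) :
    IsMildNSSolutionOn (Ico 0 T) ν f u₀ u :=
  ⟨fun t ht => h.1 t ht.1, fun t ht => h.2 t ht.1⟩

/-- `IsMildNSSolutionOn` is monotone in the time set (definitional; see `IsMildNSSolutionOn`). [folklore] -/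
theorem IsMildNSSolutionOn.mono {S S' : Set ℝ} (h : IsMildNSSolutionOn S ν f u₀ u)
    (hS : S' ⊆ S) : IsMildNSSolutionOn S' ν f u₀ u :=
  ⟨fun t ht => h.1 t (hS ht), fun t ht => h.2 t (hS ht)⟩

/-- A mild solution attains its datum weakly: `∫⟪u 0, φ⟫ = ∫⟪u₀, φ⟫` for all smooth compactly
supported divergence-free `φ`, provided `0 ∈ S` (Kato 1984, (1.7) at `t = 0`). [cite: Kato1984, (1.7] -/
theorem IsMildNSSolutionOn.integral_inner_zero_eq {S : Set ℝ} (h : IsMildNSSolutionOn S ν f u₀ u)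
    (hS : (0 : ℝ) ∈ S) {φ : E → E} (hφ : FunctionSpaces.IsTestFunctionOn (⊤ : Opens E) φ) (hdiv : VectorCalculus.IsDivFree φ) :
    ∫ x, ⟪u 0 x, φ x⟫ = ∫ x, ⟪u₀ x, φ x⟫ :=
  isMildNSSolutionFrom_zero_iff.1 (h.2 0 hS) φ hφ hdiv

/-- **Transitivity of the two-time identity** (semigroup property; Fabes–Jones–Rivière 1972,
proof of Thm. 2.1; Lemarié-Rieusset 2002, Thm. 11.2): if the identity holds between `s` and `τ`
and between `τ` and `t`, `s ≤ τ ≤ t`, then it holds between `s` and `t`. The proof inserts the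
(Schwartz, divergence-free, *not* compactly supported) field `e^{ν(t-τ)Δ}φ` as a test at time
`τ`, which requires extending the identity to such tests by density and needs `u τ ∈ L^q`
at that *specific* time (the `L^∞_t L^q_x` bound only controls a.e. time); whence the class
hypotheses `u ∈ L^∞((s,t); L^q)`, `q ≥ 2`, measurable, `u s, u τ ∈ L^q` (`hus`, `huτ`), and
`f ∈ L¹((s,t) × E)`. [cite: FabesJonesRiviere1972, proof of Thm. 2.1] -/
def IsMildNSSolutionBetween.trans : Prop :=
  ∀ {s τ t : ℝ} (h₁ : IsMildNSSolutionBetween ν f u s τ) (h₂ : IsMildNSSolutionBetween ν f u τ t) (hν : 0 < ν) (hsτ : s ≤ τ) (hτt : τ ≤ t) (hmeas : AEStronglyMeasurable (uncurry u) (volume.restrict (Ioo s t ×ˢ univ))) {q : ℝ≥0∞} (hq : 2 ≤ q) (hu : MemLqLp ∞ q u (Ioo s t)) (hus : MemLp (u s) q) (huτ : MemLp (u τ) q) (hf : IntegrableOn (uncurry f) (Ioo s t ×ˢ univ) volume),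
    IsMildNSSolutionBetween ν f u s t

/-- **Classical solutions are mild solutions** (Fabes–Jones–Rivière 1972, Thm. 2.1 (i);
Kato 1984, §1): a classical solution on `S ⊇ [0, T]` with `u`, `p`, `f` bounded on `[0, T] × E`
and `0 < ν` is a mild solution on `[0, T]` with datum `u 0`. Proof sketch: pair the momentum
equation on `[0, t] × E` with `χ_R(x) e^{ν(t-τ)Δ}φ`, integrate by parts in `x` and `τ`
(the test solves `∂_τψ + νΔψ = 0`; the pressure pairs to `-∫ p div ψ = 0` in the limit), and let
the cut-off radius `R → ∞` using boundedness of `u`, `p`, `f` and the Schwartz decay of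
`e^{ν(t-τ)Δ}φ`. [cite: FabesJonesRiviere1972, Thm. 2.1 (i] -/
def IsClassicalNSSolutionOn.isMildNSSolutionOn : Prop :=
  ∀ {S : Set ℝ} (h : IsClassicalNSSolutionOn S ν f u p) (hν : 0 < ν) (hS : Icc 0 T ⊆ S) (hu : IsBoundedOn (Icc 0 T) u) (hp : IsBoundedOn (Icc 0 T) p) (hf : IsBoundedOn (Icc 0 T) f),
    IsMildNSSolutionOn (Icc 0 T) ν f (u 0) u

/-- **Mild solutions are weak solutions** (Fabes–Jones–Rivière 1972, Thm. 2.1 (ii)⇒(i);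
Lemarié-Rieusset 2002, Thm. 11.2): a mild solution on `[0, T)` in the class
`u ∈ L^∞((0,T); L^q)`, `q ≥ 2` (measurable on `(0,T) × E`), with datum `u₀ ∈ L^q` (`hu₀`,
the Fabes–Jones–Rivière class; without it the datum term `∫ ⟪u₀, e^{νtΔ}φ⟫` may be a junk `0`
and the statement fails), `f ∈ L¹((0,T) × E)` and `0 < ν`, is a weak (pressure-free,
Leray-type) solution on `[0, T)` with datum `u₀` in the sense of `Fluid.IsWeakNSSolutionOn`.
(Local square integrability follows from `q ≥ 2`; the initial term only sees div-free `ψ(0)`,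
for which `∫⟪u 0, ψ 0⟫ = ∫⟪u₀, ψ 0⟫`.) [cite: FabesJonesRiviere1972, Thm. 2.1 (ii] -/
def IsMildNSSolutionOn.isWeakNSSolutionOn : Prop :=
  ∀ (h : IsMildNSSolutionOn (Ico 0 T) ν f u₀ u) (hν : 0 < ν) {q : ℝ≥0∞} (hu₀ : MemLp u₀ q (volume : Measure E)) (hmeas : AEStronglyMeasurable (uncurry u) (volume.restrict (Ioo 0 T ×ˢ univ))) (hq : 2 ≤ q) (hu : MemLqLp ∞ q u (Ioo 0 T)) (hf : IntegrableOn (uncurry f) (Ioo 0 T ×ˢ univ) volume),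
    IsWeakNSSolutionOn T ν f u₀ u

/-- **Duality form ⇔ semigroup Duhamel formula in `L²`** (Lemarié-Rieusset 2002, Thm. 11.2;
Kato 1984, (1.7); Fabes–Jones–Rivière 1972, Thm. 2.1), unforced case. Let `0 < ν`, `u₀ ∈ L²`,
and let `u` be measurable, bounded on `[0, T) × E`, with `u ∈ L^∞((0,T); L²)` (`hE`, the
accepted `MemLqLp ∞ 2`; needed for the `L²`-Bochner Duhamel integral to converge). The
everywhere hypotheses `hu` (every slice `u t ∈ L²`, `t ∈ [0, T)`) and `hb` (pointwise bound) are
stronger than the a.e. classes used elsewhere in this file: `hu` is what `MemLp.toLp` needs to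
name the `L²` class of `u t` at *every* `t`, and `hb` makes `heatDivTensor` an honest
integral. Then `u` is a mild solution on `[0, T)` iff for every `t ∈ [0, T)`, in `L²(E; E)`,
`u(t) = e^{νtΔ} P u₀ - ∫₀ᵗ P e^{ν(t-τ)Δ} div (u ⊗ u)(τ) dτ`,
`P = Fluid.lerayProjector E` (which commutes with `e^{τΔ}` on `E`). The `L²` classes of
`e^{νtΔ} P u₀` and of `e^{ν(t-τ)Δ} div (u ⊗ u)(τ) = heatDivTensor (ν (t - τ)) (u τ) (u τ)` are
introduced through representatives `v₀`, `N τ` (they exist under the hypotheses: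
`‖∇K_σ ⋆ (u ⊗ u)‖₂ ≤ C σ^{-1/2} ‖u‖_∞ ‖u‖₂`, integrable at `σ = 0`); the time integral is the
Bochner integral in `L²`. The datum enters only through `P u₀` (`= u₀` when `u₀` is weakly
divergence free). [cite: LemarieRieusset2002, Thm. 11.2] -/
def isMildNSSolutionOn_iff_duhamel_two : Prop :=
  ∀ (hν : 0 < ν) (hu₀ : MemLp u₀ 2 (volume : Measure E)) (hmeas : AEStronglyMeasurable (uncurry u) (volume.restrict (Ioo 0 T ×ˢ univ))) (hu : ∀ t ∈ Ico 0 T, MemLp (u t) 2 (volume : Measure E)) (hb : IsBoundedOn (Ico 0 T) u) (hE : MemLqLp ∞ 2 u (Ioo 0 T)),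
    IsMildNSSolutionOn (Ico 0 T) ν 0 u₀ u ↔
      ∀ t (ht : t ∈ Ico 0 T), ∃ (v₀ : Lp E 2 (volume : Measure E))
        (N : ℝ → Lp E 2 (volume : Measure E)),
        (v₀ : E → E) =ᵐ[volume]
          heatFlow ((lerayProjector E (hu₀.toLp u₀) : Lp E 2 (volume : Measure E)) : E → E)
            (ν * t) ∧
        (∀ τ ∈ Ioo 0 t, (N τ : E → E) =ᵐ[volume] heatDivTensor (ν * (t - τ)) (u τ) (u τ)) ∧
        (hu t ht).toLp (u t) = v₀ - ∫ τ in 0..t, lerayProjector E (N τ)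

/-- **Uniqueness of mild solutions in `C([0,T); L³(ℝ³))`** (Kato 1984, Thm. 2 for the
existence class; Furioli–Lemarié-Rieusset–Terraneo 2000, Thm. 1, unconditional uniqueness;
Lemarié-Rieusset 2002, Ch. 27): on a three-dimensional space, two unforced mild solutions on
`[0, T)` with the same datum `u₀ ∈ L³` (`hu₀`, Kato's class), both in `C([0,T); L³)` and
measurable on `(0,T) × E`, agree a.e. at every time. [cite: Kato1984, Thm. 2 for the existence class] -/
def IsMildNSSolutionOn.ae_eq_of_continuousInLpOn_three : Prop :=
  ∀ (hd : Module.finrank ℝ E = 3) (hν : 0 < ν) (hu₀ : MemLp u₀ 3 (volume : Measure E)) (h₁ : IsMildNSSolutionOn (Ico 0 T) ν 0 u₀ u) (h₂ : IsMildNSSolutionOn (Ico 0 T) ν 0 u₀ v) (hu : ContinuousInLpOn (Ico 0 T) 3 u) (hv : ContinuousInLpOn (Ico 0 T) 3 v) (hmu : AEStronglyMeasurable (uncurry u) (volume.restrict (Ioo 0 T ×ˢ univ))) (hmv : AEStronglyMeasurable (uncurry v) (volume.restrict (Ioo 0 T ×ˢ univ))),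
    ∀ t ∈ Ico 0 T, u t =ᵐ[volume] v t

end Mild

end Literature.Analysis.FluidPDE
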